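/-
Copyright: public-domain mathematics; typed transcription for the H21 Literature library (cell lit-balaban,
reader/typer seat r02 gen 5 = literature-prover-lit-balaban-r02-g5-0).

statement-level skeleton of published theorems with citation tags; proofs where landed; nothing here is a claim about the Yang–Mills mass gap

# Bałaban, *Propagators and renormalization transformations for lattice gauge theories. I*,
# Commun. Math. Phys. **95** (1984) 17–40 — the unit cubes `Δ(y) = B^k(y)` PARTITION `T_η`, have `n^d` points, and sit inside `Δ̃(y)`
# (the bookkeeping of the (1.132)/(1.133) cube pieces `1_{Δ(y″)}` on the product torus)

[cite: Balaban1984PropagatorsI]  T. Bałaban, Commun. Math. Phys. 95 (1984) 17–40.  p. 35: «Cubes Δ(y) are simply unit cubes of T_η, or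
Δ(y) = B^k(y), and Δ̃(y) are sums of 2^d unit cubes having the point y as a corner»; p. 39 (1.132)–(1.133) (the sums over y′ ∈ T₁^{(k)}
of cube pieces); p. 21 (1.21) (η^d Σ_{x ∈ B(y)} = 1).

WHAT THIS MODULE ADDS (SKELETON row B5.Prop1.2 census (vii)): for `cube1 n M y` of `B5Prop12FieldsLattice` — `blockLabel` (`⌊x/n⌋` as a point
of `Tor M`), `mem_cube1_iff` (`x ∈ Δ(y) ↔ ⌊x/n⌋ = y`), `sum_ite_mem_cube1` (exactly one cube contains `x`: `Σ_y 1_{Δ(y)}(x) = 1`),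
`cube1_subset_cubeT` (`Δ(y) ⊆ Δ̃(y)`), `card_cube1` (`#Δ(y) = n^d`, so `η^d·#Δ(y) = 1`).

HONEST SCOPE.  Elementary; nothing analytic.
-/
import Mathlib
import Literature.MathematicalPhysics.QuantumFieldTheory.Balaban1983to89.B5Carrier132CubeGeom

open scoped BigOperators
open Finset

namespace Literature.MathematicalPhysics.QuantumFieldTheory.Balaban1983to89.B5Cube1Partition

open Literature.MathematicalPhysics.QuantumFieldTheory.Balaban1983to89
open Literature.MathematicalPhysics.QuantumFieldTheory.Balaban1983to89.B5Prop11Plancherel (Tor fine)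
open Literature.MathematicalPhysics.QuantumFieldTheory.Balaban1983to89.B5Prop12FieldsLattice (cube1 cubeT)
open Literature.MathematicalPhysics.QuantumFieldTheory.Balaban1983to89.B5CoverP12Lattice (mem_cubeT_iff_crep)
open Literature.MathematicalPhysics.QuantumFieldTheory.Balaban1983to89.B5Carrier132CubeGeom (abs_crep_uc_sub_of_mem_cube1)
open Literature.MathematicalPhysics.QuantumFieldTheory.Balaban1983to89.B6Cov2156Torus (one_le_M)

noncomputable section

variable {d : ℕ} (M : Fin d → ℕ) [hM : ∀ μ, NeZero (M μ)] (n : ℕ) [NeZero n]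

/-! ## §1 The block label and membership -/

/-- **`⌊x/n⌋ ∈ T₁`**: the unit cube containing the fine site `x`. [cite: Balaban1984PropagatorsI, p.35 (Δ(y) = B^k(y))] -/
def blockLabel (x : Tor (fine n M)) : Tor M := fun μ => (((x μ).val / n : ℕ) : ZMod (M μ))

omit hM in
/-- the quotient is a legitimate residue: `⌊x_μ/n⌋ < M_μ`. [cite: Balaban1984PropagatorsI, p.35] -/
theorem val_div_lt [hM : ∀ μ, NeZero (M μ)] (x : Tor (fine n M)) (μ : Fin d) : (x μ).val / n < M μ := by
  have hx : (x μ).val < n * M μ := ZMod.val_lt (x μ)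
  exact Nat.div_lt_of_lt_mul hx

omit hM in
/-- `(⌊x/n⌋_μ).val = x_μ.val / n`. [cite: Balaban1984PropagatorsI, p.35] -/
theorem blockLabel_val [hM : ∀ μ, NeZero (M μ)] (x : Tor (fine n M)) (μ : Fin d) : (blockLabel M n x μ).val = (x μ).val / n := by
  unfold blockLabel
  exact ZMod.val_natCast_of_lt (val_div_lt M n x μ)

omit hM in
/-- **`x ∈ Δ(y) ↔ ⌊x/n⌋ = y`.** [cite: Balaban1984PropagatorsI, p.35 (Δ(y) = B^k(y))] -/
theorem mem_cube1_iff [hM : ∀ μ, NeZero (M μ)] (x : Tor (fine n M)) (y : Tor M) : x ∈ cube1 n M y ↔ blockLabel M n x = y := by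
  rw [cube1, Finset.mem_filter]
  simp only [Finset.mem_univ, true_and]
  constructor
  · intro h
    funext μ
    apply ZMod.val_injective
    rw [blockLabel_val, h μ]
  · intro h μ
    rw [← h, blockLabel_val]

omit hM in
/-- **the unit cubes partition `T_η`**: `Σ_{y ∈ T₁} 1_{Δ(y)}(x) · c(y) = c(⌊x/n⌋)`. [cite: Balaban1984PropagatorsI, p.35, (1.132)–(1.133) p.39] -/
theorem sum_ite_mem_cube1 [hM : ∀ μ, NeZero (M μ)] {β : Type} [AddCommMonoid β] (x : Tor (fine n M)) (c : Tor M → β) :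
    (∑ y, if x ∈ cube1 n M y then c y else 0) = c (blockLabel M n x) := by
  have h : ∀ y, (x ∈ cube1 n M y) = (blockLabel M n x = y) := fun y => propext (mem_cube1_iff M n x y)
  simp_rw [h]
  rw [Finset.sum_ite_eq Finset.univ (blockLabel M n x) c]
  simp

omit hM in
/-- `x ∈ Δ(⌊x/n⌋)`. [cite: Balaban1984PropagatorsI, p.35] -/
theorem mem_cube1_blockLabel [hM : ∀ μ, NeZero (M μ)] (x : Tor (fine n M)) : x ∈ cube1 n M (blockLabel M n x) :=
  (mem_cube1_iff M n x _).mpr rfl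

omit hM in
/-- **`Δ(y) ⊆ Δ̃(y)`.** [cite: Balaban1984PropagatorsI, p.35 («Δ̃(y) are sums of 2^d unit cubes having the point y as a corner»)] -/
theorem cube1_subset_cubeT [hM : ∀ μ, NeZero (M μ)] (hn : 1 ≤ n) (y : Tor M) : cube1 n M y ⊆ cubeT n M y := by
  intro x hx
  rw [mem_cubeT_iff_crep M n hn]
  exact fun μ => abs_crep_uc_sub_of_mem_cube1 M n hn hx μ

/-! ## §2 `#Δ(y) = n^d` -/

omit hM in
/-- the offset parametrisation of a unit cube: `r ↦ n·y + r`. [cite: Balaban1984PropagatorsI, p.35, (1.21) p.21] -/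
theorem cube1_eq_image [hM : ∀ μ, NeZero (M μ)] (y : Tor M) :
    cube1 n M y = Finset.univ.image (fun r : Fin d → Fin n => fun μ => (((n * (y μ).val + r μ : ℕ)) : ZMod (fine n M μ))) := by
  ext x
  rw [mem_cube1_iff, Finset.mem_image]
  have hlt : ∀ (μ : Fin d) (r : Fin n), n * (y μ).val + r < fine n M μ := fun μ r => by
    have hy : (y μ).val < M μ := ZMod.val_lt (y μ)
    have hr : (r : ℕ) < n := r.isLt
    show n * (y μ).val + r < n * M μ
    calc n * (y μ).val + r < n * (y μ).val + n := by omega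
      _ = n * ((y μ).val + 1) := by ring
      _ ≤ n * M μ := Nat.mul_le_mul_left _ hy
  have hnpos : 0 < n := Nat.pos_of_ne_zero (NeZero.ne n)
  constructor
  · intro h
    refine ⟨fun μ => ⟨(x μ).val % n, Nat.mod_lt _ hnpos⟩, Finset.mem_univ _, ?_⟩
    funext μ
    apply ZMod.val_injective
    rw [ZMod.val_natCast_of_lt (hlt μ _)]
    have hb := blockLabel_val M n x μ
    rw [h] at hb
    show n * (y μ).val + (x μ).val % n = (x μ).val
    rw [hb]
    exact Nat.div_add_mod _ _
  · rintro ⟨r, -, rfl⟩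
    funext μ
    apply ZMod.val_injective
    rw [blockLabel_val]
    show ((((n * (y μ).val + r μ : ℕ)) : ZMod (fine n M μ))).val / n = (y μ).val
    rw [ZMod.val_natCast_of_lt (hlt μ (r μ)), Nat.mul_add_div hnpos, Nat.div_eq_of_lt (r μ).isLt, add_zero]

omit hM in
/-- **`#Δ(y) = n^d`** (so `η^d · #Δ(y) = 1`, (1.21)). [cite: Balaban1984PropagatorsI, p.35, (1.21) p.21] -/
theorem card_cube1 [hM : ∀ μ, NeZero (M μ)] (y : Tor M) : (cube1 n M y).card = n ^ d := by
  rw [cube1_eq_image, Finset.card_image_of_injective]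
  · simp
  · intro r r' h
    funext μ
    have hμ := congr_fun h μ
    have hlt : ∀ (r : Fin n), n * (y μ).val + r < fine n M μ := fun r => by
      have hy : (y μ).val < M μ := ZMod.val_lt (y μ)
      have hr : (r : ℕ) < n := r.isLt
      show n * (y μ).val + r < n * M μ
      calc n * (y μ).val + r < n * (y μ).val + n := by omega
        _ = n * ((y μ).val + 1) := by ring
        _ ≤ n * M μ := Nat.mul_le_mul_left _ hy
    have hv := congr_arg ZMod.val hμ
    simp only at hv
    rw [ZMod.val_natCast_of_lt (hlt (r μ)), ZMod.val_natCast_of_lt (hlt (r' μ))] at hv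
    exact Fin.ext (by omega)

end

end Literature.MathematicalPhysics.QuantumFieldTheory.Balaban1983to89.B5Cube1Partition
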